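import Summits.QuantumAdvantage.QuantumAdvantage.Theorems.AcZeroRung.Negative.LoadBearing
import Literature.NumberTheory.QuadraticFields.ThreeTorsion
import Literature.Barriers.PneNP.LowDegreeCounterexamples

/-!
# Crux `ArithStatLadder.AcZeroRung` (stmt-QuantumAdvantage-2425): objects of the line `dyadic-chirp-poisson`

Definitions (no proofs of stubs; one composition lemma `dyadicTwistBound_of`) used by the positive-side files of this crux, i.e. by the registered
stubs of the checked skeleton `Cruxes/AcZeroRung/Lines/dyadic_chirp_poisson.lean` (lead
`prover-line-stmt-QuantumAdvantage-2425-0`, reshape v1, 7 stubs) and by its composition theorem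
`AcZeroRung_of`:

* the centred statistic `tauC d = #Cl(ℚ(√−d))[3] − 2` (`quadFieldThreeTorsion`, Davenport–Heilbronn
  mean `2`), the additive character `e`, and the line's currency, the twisted block sum
  `twistSum n α = Σ_{d ∈ 𝒟_n} (τ(d) − 2)·e(αd)` over the crux's family `famD n` (landed
  `Theorems/AcZeroRung/Negative/LoadBearing.lean`, verbatim the route's finset);
* the HYBRID MAJOR ARCS `HybridMajorArc δ n α` (2-adic conductor × archimedean conductor ≤ `X^{1/2−δ}`,
  `X = 2ⁿ`) and the three analytic statements of the line: `HybridArcBound` (STUB B, the B-process),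
  `MinorArcBound` (STUB X, Davenport–Heilbronn on the dyadic minor arcs — open), `DyadicTwistBound`
  (their meeting point: a power saving at every dyadic frequency of level `≤ n`);
* the circuit-side currency `WalshBiasQP` (quasi-polynomially small class-restricted Walsh biases of
  `τ − 2`, the output of STUB G1) and the shape `BravermanFoolsAC0` of Braverman's theorem
  (polylog-wise independence fools AC⁰) over the tree's `Circuit`/`acBasis`/`IsDWiseIndependent`.

Statements are verbatim those of the planner's checked skeleton (planner-cruxplan, round 1) as reshaped
by the lead; the stubs themselves and the composition live in the skeleton / the stub files, not here.
Pattern: `Summits/ABC/ABC/Theorems/TwistAmplificationSharpModerateLawDefs.lean`.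
-/

set_option linter.dupNamespace false -- D-0017: single-problem summit ⇒ `QuantumAdvantage.QuantumAdvantage` by design

noncomputable section

namespace Summit.QuantumAdvantage.QuantumAdvantage.Theorems.AcZeroRung

open scoped BigOperators Classical
open Filter Finset
open Literature.NumberTheory.QuadraticFields (quadFieldThreeTorsion)
open Literature.Computability.Complexity (Circuit acBasis)
open Literature.Probability.RandomGraphs.LowDegree (sgn walsh)
open Literature.Barriers.PneNP (IsDWiseIndependent)
open Summit.QuantumAdvantage.QuantumAdvantage.Theorems.AcZeroRung.Negative (famD)

/-! ## The frequency currency -/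

/-- The centred statistic `τ(d) − 2`, `τ(d) = #Cl(ℚ(√−d))[3] = quadFieldThreeTorsion (−d)`
(Davenport–Heilbronn mean `2` over imaginary quadratic fields). -/
def tauC (d : ℕ) : ℝ := (quadFieldThreeTorsion (-(d:ℤ)) : ℝ) - 2

/-- The additive character `e(x) = exp(2π i x)`. -/
def e (x : ℝ) : ℂ := Complex.exp (2 * Real.pi * Complex.I * (x : ℂ))

/-- The currency of the line: the twisted block sum `F_n(α) = Σ_{d ∈ 𝒟_n} (τ(d) − 2) · e(α d)` over the
crux's family `𝒟_n = famD n` of `n`-bit `d` with `−d` fundamental. -/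
def twistSum (n : ℕ) (α : ℝ) : ℂ := ∑ d ∈ famD n, (tauC d : ℂ) * e (α * d)

/-- HYBRID MAJOR ARC at level `X^{1/2−δ}`, `X = 2ⁿ`: `α` is within `2^{(1/2−δ)n}·2^{−m−n}` of a dyadic
`a/2^m`, jointly "2-adic conductor `2^m` × archimedean conductor `(1 + X|β|)` ≤ `X^{1/2−δ}`"
(`m ≤ (1/2−δ)n` is forced). Contains the pure 2-adic arcs (`β = 0`) and the `q = 1` arc (`m = 0`). -/
def HybridMajorArc (δ : ℝ) (n : ℕ) (α : ℝ) : Prop :=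
  ∃ m : ℕ, ∃ a : ℤ, (2:ℝ) ^ m * (1 + (2:ℝ) ^ n * |α - a / (2:ℝ) ^ m|) ≤ (2:ℝ) ^ ((1 / 2 - δ) * (n:ℝ))

/-- STUB B's statement — POWER SAVING ON THE HYBRID MAJOR ARCS: for every `δ > 0` some `η > 0`,
eventually in `n`, `|F_n(α)| ≤ 2^{(1−η)n}` for every `α ∈ HybridMajorArc δ n` (the B-process: one
Poisson summation over Bhargava–Shankar–Tsimerman's averaged regions with the discriminant-chirp
weight; degenerate members: the dyadic Davenport–Heilbronn mean at `a = 0`, the class means mod 16 at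
`a/16`, the `q = 1` archimedean arc at `m = 0`). -/
def HybridArcBound : Prop :=
  ∀ δ : ℝ, 0 < δ → ∃ η : ℝ, 0 < η ∧ ∀ᶠ n : ℕ in atTop, ∀ α : ℝ, HybridMajorArc δ n α →
    ‖twistSum n α‖ ≤ (2:ℝ) ^ ((1 - η) * (n:ℝ))

/-- STUB X's statement — POWER SAVING ON THE DYADIC MINOR ARCS ("Davenport–Heilbronn on minor arcs",
open): for SOME `δ > 0` and `η > 0`, eventually in `n`, `|F_n(a/2^m)| ≤ 2^{(1−η)n}` for every dyadic
`a/2^m`, `m ≤ n`, OUTSIDE `HybridMajorArc δ n`. -/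
def MinorArcBound : Prop :=
  ∃ δ : ℝ, 0 < δ ∧ ∃ η : ℝ, 0 < η ∧ ∀ᶠ n : ℕ in atTop, ∀ m : ℕ, m ≤ n → ∀ a : ℤ,
    ¬ HybridMajorArc δ n ((a : ℝ) / (2:ℝ) ^ m) →
      ‖twistSum n ((a : ℝ) / (2:ℝ) ^ m)‖ ≤ (2:ℝ) ^ ((1 - η) * (n:ℝ))

/-- The meeting point of STUBS B and X: a power saving at EVERY dyadic frequency of level `≤ n`
(`∃ η > 0`, eventually `|F_n(a/2^m)| ≤ 2^{(1−η)n}` for all `m ≤ n`, `a`). -/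
def DyadicTwistBound : Prop :=
  ∃ η : ℝ, 0 < η ∧ ∀ᶠ n : ℕ in atTop, ∀ m : ℕ, m ≤ n → ∀ a : ℤ,
    ‖twistSum n ((a : ℝ) / (2:ℝ) ^ m)‖ ≤ (2:ℝ) ^ ((1 - η) * (n:ℝ))


/-! ## Hybrid ∪ minor = every dyadic frequency (the one composition step that lives with the vocabulary) -/

/-- Monotonicity of the rate `2^{(1−η)n}` in `η`. -/
theorem rate_mono {η η' : ℝ} (hle : η ≤ η') (n : ℕ) :
    (2:ℝ) ^ ((1 - η') * (n:ℝ)) ≤ (2:ℝ) ^ ((1 - η) * (n:ℝ)) :=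
  Real.rpow_le_rpow_of_exponent_le one_le_two
    (mul_le_mul_of_nonneg_right (by linarith) (Nat.cast_nonneg n))

/-- **HYBRID ∪ MINOR = ALL DYADIC FREQUENCIES** (registered sub-goal `dyadicTwistBound_of` of
stmt-QuantumAdvantage-2425): STUB B's conclusion and STUB X give the power saving at every `a/2^m`,
`m ≤ n` — take STUB X's `δ`, feed it to STUB B, `η = min`, and split on membership in
`HybridMajorArc δ n`. -/
theorem dyadicTwistBound_of : HybridArcBound → MinorArcBound → DyadicTwistBound := by
  intro hB hX
  obtain ⟨δ, hδ, ηX, hηX, hXn⟩ := hX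
  obtain ⟨ηB, hηB, hBn⟩ := hB δ hδ
  refine ⟨min ηB ηX, lt_min hηB hηX, ?_⟩
  filter_upwards [hBn, hXn] with n h1 h2 m hm a
  by_cases hα : HybridMajorArc δ n ((a : ℝ) / (2:ℝ) ^ m)
  · exact (h1 _ hα).trans (rate_mono (min_le_left _ _) n)
  · exact (h2 m hm a hα).trans (rate_mono (min_le_right _ _) n)

/-! ## The circuit-side currency -/

/-- (W) IN BIAS FORM with quasi-polynomial savings, CLASS BY CLASS mod 16: for every `A`, eventually
in `n`, for every residue `r` and every Walsh character on at most `(log₂ n)^A` digit positions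
(`S = ∅` included — then it is the class mean with a rate),
`|Σ_{d ∈ 𝒟_n, d ≡ r (16)} (τ(d) − 2) w_S(bits d)| ≤ 2^{n − (log₂ n)^{A+2}}`. -/
def WalshBiasQP : Prop :=
  ∀ A : ℕ, ∀ᶠ n : ℕ in atTop, ∀ r : ℕ, ∀ S : Finset (Fin n), S.card ≤ Nat.log 2 n ^ A →
    |∑ d ∈ (famD n).filter (fun d => d % 16 = r), tauC d * walsh S (fun i : Fin n => Nat.testBit d i)|
      ≤ (2:ℝ) ^ ((n:ℝ) - (Nat.log 2 n : ℝ) ^ (A + 2))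

/-- BRAVERMAN'S THEOREM as a shape over the tree's circuits and `IsDWiseIndependent` (Braverman,
J. ACM 57 (2010), Thm 1; Tal, CCC 2017, Thm 7.2; Harsha–Srinivasan 2019): for depth `k`, size `p(n)`,
accuracy `ε` there is `A` such that, eventually in the input length `m`, every `(log₂ m)^A`-wise
independent distribution `ε`-fools every such circuit over `acBasis`. This is the statement of the
registered stub `stub_braverman` (shared verbatim by the three lines of the crux); it is NOT asserted here. -/
def BravermanFoolsAC0 : Prop :=
  ∀ (k : ℕ) (p : Polynomial ℕ) (ε : ℝ), 0 < ε → ∃ A : ℕ, ∀ᶠ m : ℕ in Filter.atTop,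
    ∀ C : Circuit (Fin m), C.IsOver acBasis → C.acDepth ≤ k → C.size ≤ p.eval m →
    ∀ μ : PMF (Fin m → Bool), IsDWiseIndependent (Nat.log 2 m ^ A) μ →
      |∑ x, (μ x).toReal * sgn (C.eval x) - (∑ x : Fin m → Bool, sgn (C.eval x)) / 2 ^ m| ≤ ε

end Summit.QuantumAdvantage.QuantumAdvantage.Theorems.AcZeroRung

end
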